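import Literature.MathematicalPhysics.QuantumFieldTheory.Balaban1983to89.B9Thm37GlueDir
import Literature.MathematicalPhysics.QuantumFieldTheory.Balaban1983to89.B9RWSums344InputPair

/-!
# `Balaban1983to89.B9Thm37KLetterDir` — THE K-LETTER OF (3.88) OVER THE DIRECTION LETTERS: `K(h_□) = Σ_μ P_{□,μ}∇_{U,μ} + C_□` (`KopDir`), its transpose
# `Σ_μ ∇*_{U,μ}Pᵗ_{□,μ} + Cᵗ_□` (`KoptDir`), `R′ = Σ_□ K(h_□)G′_□M_{h_□}` (`RprimeDir`), `V = Σ_□ M_{h_□}G′_□K(h_□)ᵗ` (`VDir`); the fixed points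
# `G′ = G′₀ + G′R′` ∕ `G′ = G′₀ + VG′` and the (3.89) majorants from `Identities₂` — the base of the engine re-thread (ruling R1′)

T. Bałaban, *Propagators for lattice gauge theories in a background field*, Commun. Math. Phys. **99** (1985) 389–434
[`Balaban1985BackgroundPropagators`, "B9"], (3.87)–(3.90) pp. 408–410; T. Bałaban, *Propagators and renormalization transformations for lattice gauge
theories. II*, Commun. Math. Phys. **96** (1984) 223–250 [`Balaban1984PropagatorsII`, "[4]"], (2.39)–(2.44) pp. 229–230, (2.51)–(2.55) p. 232.

statement-level skeleton of published theorems with citation tags; proofs where landed; nothing here is a claim about the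
Yang–Mills mass gap

WHY THIS FILE (cell `pub-ymgap`, Track A node N06 [B9], rows 18–19; dag-n06-d g10 «re-thread the engine over `Identities₂`» (bus l.30681); seat
`pub-ymgap-dag-n06-c` g10).  n06-k's Sect.-C engine (`B9RWSums343HolderGp`, `…344Input(Gp∕Pair)`, `…346Lap∕MixedPair∕SecondDiffGp∕TwoGp`, the aggregators up to
`B9RWSumsDefinitePinsPairM.rows131819_definite_geo9Y_pairM`) consumes `B9Thm37Whole.Identities` in exactly two ways: (a) the fixed points
`fixedPoint_of_388 hi.inv hi.eq388 : G′ = G′₀ + G′·R′` ∕ `fixedPoint_of_388T … hi.eq388T : G′ = G′₀ + V·G′` with the v1 K-letter `𝔬.P U □ ∘ₗ 𝔬.D U + 𝔬.Cop U □`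
spelled out in `R′`, `V` and in every displayed «Factors…» schema; (b) the (3.89) majorant of `R′` (`h389_of_342 … hi.hP hi.hC`, `343HolderGp` only).
Under the ruling R1′ the K-letter is the direction sum; THIS FILE names it once and re-derives (a) and (b) from `Identities₂`, so that every v2 schema and
face is the v1 text with `𝔬.P U i ∘ₗ 𝔬.D U + 𝔬.Cop U i ↦ KopDir 𝔬 𝔡 𝔩 U i`, `𝔬.Dstar U ∘ₗ 𝔬.Pt U i + 𝔬.Ct U i ↦ KoptDir 𝔬 𝔡 𝔩 U i`, `hfix ↦ fixedPoint_dir`: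
* §1 defs `KopDir`, `KoptDir`, `RprimeDir`, `VDir`; `KopDir_eq_stacked` (= `costackDir P ∘ₗ stackDir ∇ + C`, the v1 shape at `Y′ := X × Dir`), `KoptDir_eq_stacked`;
* §2 ★ `eq388_K ∕ eq388T_K` ((3.88) and its transpose with the K-letters), ★★ `fixedPoint_dir : G′ = G′₀ + G′·R′`,
  ★★ `fixedPointT_dir : G′ = G′₀ + V·G′`;
* §3 ★★ `h389_dir` — (3.89) per cube for `K(h_□)G′_□M_h` from Corollary 3.6 (`Local342.e0∕e1`), the per-direction entries (`DirSupSq37`) and the per-direction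
  majorants of `Identities₂` (kernel `KP` through `KPd_sum`, no `#Dir`); ★ `hR_dir` — summed with the overlap count `N′`; ★ `hV_cube_dir` — the transposed cube
  majorant `M_hG′_□K(h_□)ᵗ` (`B9Thm37GlueDir.rightR_cube_majorant_dir`), ★ `hV_dir` — summed.

HONEST SCOPE.  Definitions and majorant bookkeeping; (3.88), Corollary 3.6 and the sizes are HYPOTHESES (schemas); nothing of [B9] asserted; COUNT-NEUTRAL; N06 NOT
discharged; one finite lattice programme — nothing continuum, nothing about OS positivity or the mass gap.
-/

namespace Literature.MathematicalPhysics.QuantumFieldTheory.Balaban1983to89.B9Thm37KLetterDir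

open Finset B6RandomWalk B6RandomWalkHom B9Thm37Sum B9Thm34Ext B9Thm37Glue B9Thm37Whole B9Thm37WholeDir B9Thm37GlueDir
  B9RWSums346SecondDiffGp B9RWSums343Holder B11SectG B9SectDL2Decay

noncomputable section

variable {g : B9.Geometry} [Fintype g.Site] [DecidableEq g.Site] {B : B9.Backgrounds} {X Y ι Dir : Type} [Fintype ι] [Fintype Dir]

/-! ## §1 The K-letters -/

/-- **`K(h_□) = Σ_μ P_{□,μ}∇_{U,μ} + C_□`** over the direction letters ((3.88) p. 409; [4] (2.39)–(2.40)). [cite: Balaban1985BackgroundPropagators, (3.88) p.409; Balaban1984PropagatorsII, (2.39)–(2.40) pp.229–230] -/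
def KopDir (𝔬 : Ops g B X Y ι) (𝔡 : DirOps37 𝔬 Dir) (𝔩 : DirLetters37 𝔬 Dir) (U : B.Cfg) (i : ι) : Module.End ℝ (X → ℝ) :=
  (∑ μ, 𝔩.P U i μ * 𝔡.Dd U μ) + 𝔬.Cop U i

/-- **`K(h_□)ᵗ-form = Σ_μ ∇*_{U,μ}Pᵗ_{□,μ} + Cᵗ_□`** (the transposed (3.88)). [cite: Balaban1985BackgroundPropagators, (3.88) p.409 + p.391 (∇* the adjoint)] -/
def KoptDir (𝔬 : Ops g B X Y ι) (𝔡 : DirOps37 𝔬 Dir) (𝔩 : DirLetters37 𝔬 Dir) (U : B.Cfg) (i : ι) : Module.End ℝ (X → ℝ) :=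
  (∑ μ, 𝔡.Dsd U μ * 𝔩.Pt U i μ) + 𝔬.Ct U i

/-- **`R′ = Σ_□ K(h_□)G′_□h_□`** ((3.88): `Δ′_aG′₀ = I − R′`). [cite: Balaban1985BackgroundPropagators, (3.88) p.409] -/
def RprimeDir (𝔬 : Ops g B X Y ι) (𝔡 : DirOps37 𝔬 Dir) (𝔩 : DirLetters37 𝔬 Dir) (U : B.Cfg) : Module.End ℝ (X → ℝ) :=
  ∑ i, KopDir 𝔬 𝔡 𝔩 U i * 𝔬.Gsq U i * mulOp (𝔬.h i)

/-- **`V = Σ_□ h_□G′_□K(h_□)ᵗ`** (the transposed (3.88): `G′₀Δ′_a = I − V`). [cite: Balaban1985BackgroundPropagators, (3.88) p.409] -/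
def VDir (𝔬 : Ops g B X Y ι) (𝔡 : DirOps37 𝔬 Dir) (𝔩 : DirLetters37 𝔬 Dir) (U : B.Cfg) : Module.End ℝ (X → ℝ) :=
  ∑ i, mulOp (𝔬.h i) * 𝔬.Gsq U i * KoptDir 𝔬 𝔡 𝔩 U i

variable (𝔬 : Ops g B X Y ι) (𝔡 : DirOps37 𝔬 Dir) (𝔩 : DirLetters37 𝔬 Dir) (U : B.Cfg)

omit [Fintype g.Site] [DecidableEq g.Site] [Fintype ι] in
/-- `K(h_□)` IS the v1-shaped letter `P′_□ ∘ D′ + C_□` at the stacked derivative `D′ = stackDir ∇_{U,·}`, `P′_□ = costackDir P_{□,·}`.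
[cite: Balaban1985BackgroundPropagators, (3.88) p.409, dictionary] -/
theorem KopDir_eq_stacked (i : ι) : KopDir 𝔬 𝔡 𝔩 U i = costackDir (𝔩.P U i) ∘ₗ stackDir (𝔡.Dd U) + 𝔬.Cop U i := by
  rw [KopDir, costackDir_comp_stackDir]

omit [Fintype g.Site] [DecidableEq g.Site] [Fintype ι] in
/-- `K(h_□)ᵗ` IS `Dstar′ ∘ Pt′_□ + Cᵗ_□` at `Dstar′ = costackDir ∇*_{U,·}`, `Pt′_□ = stackDir Pt_{□,·}`. [cite: Balaban1985BackgroundPropagators, (3.88) p.409, dictionary] -/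
theorem KoptDir_eq_stacked (i : ι) : KoptDir 𝔬 𝔡 𝔩 U i = costackDir (𝔡.Dsd U) ∘ₗ stackDir (𝔩.Pt U i) + 𝔬.Ct U i := by
  rw [KoptDir, costackDir_comp_stackDir]

/-! ## §2 (3.88) with the K-letters and the two fixed points -/

variable {𝔬 𝔡 𝔩 U} {R : ℝ} {H : Prop}

omit [DecidableEq g.Site] in
/-- ★ **(3.88) with the K-letter**: `Δ′_a G′₀ = 1 − Σ_□ K(h_□)G′_□M_{h_□}`. [cite: Balaban1985BackgroundPropagators, (3.88) p.409] -/
theorem eq388_K (hi : Identities₂ 𝔬 𝔡 𝔩 R H U) :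
    𝔬.Δa U * (∑ i, mulOp (𝔬.h i) * 𝔬.Gsq U i * mulOp (𝔬.h i)) = 1 - ∑ i, KopDir 𝔬 𝔡 𝔩 U i * 𝔬.Gsq U i * mulOp (𝔬.h i) :=
  hi.eq388

omit [DecidableEq g.Site] in
/-- ★ **the transposed (3.88) with the K-letter**: `G′₀Δ′_a = 1 − Σ_□ M_{h_□}G′_□K(h_□)ᵗ`. [cite: Balaban1985BackgroundPropagators, (3.88) p.409] -/
theorem eq388T_K (hi : Identities₂ 𝔬 𝔡 𝔩 R H U) :
    (∑ i, mulOp (𝔬.h i) * 𝔬.Gsq U i * mulOp (𝔬.h i)) * 𝔬.Δa U = 1 - ∑ i, mulOp (𝔬.h i) * 𝔬.Gsq U i * KoptDir 𝔬 𝔡 𝔩 U i :=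
  hi.eq388T

omit [DecidableEq g.Site] in
/-- ★★ **`G′ = G′₀ + G′R′`** ((3.88) and `G′Δ′_a = I`; (3.90) summed). [cite: Balaban1985BackgroundPropagators, (3.88)–(3.90) p.409] -/
theorem fixedPoint_dir (hi : Identities₂ 𝔬 𝔡 𝔩 R H U) :
    𝔬.Gp U = (∑ i, mulOp (𝔬.h i) * 𝔬.Gsq U i * mulOp (𝔬.h i)) + 𝔬.Gp U * RprimeDir 𝔬 𝔡 𝔩 U :=
  fixedPoint_of_388 hi.inv (eq388_K hi)

omit [DecidableEq g.Site] in
/-- ★★ **`G′ = G′₀ + VG′`** (the transposed (3.88) and `Δ′_aG′ = I`, the sites being finite). [cite: Balaban1985BackgroundPropagators, (3.88) p.409] -/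
theorem fixedPointT_dir [Fintype X] [DecidableEq X] (hi : Identities₂ 𝔬 𝔡 𝔩 R H U) :
    𝔬.Gp U = (∑ i, mulOp (𝔬.h i) * 𝔬.Gsq U i * mulOp (𝔬.h i)) + VDir 𝔬 𝔡 𝔩 U * 𝔬.Gp U :=
  fixedPoint_of_388T (mul_eq_one_comm.mp hi.inv) (eq388T_K hi)

/-! ## §3 The (3.89) majorants of `R′` and of `V` from Corollary 3.6, the per-direction entries and `Identities₂` -/

/-- ★★ **(3.89) PER CUBE FOR `K(h_□)G′_□M_{h_□}` OVER THE DIRECTION LETTERS**: `|K(h_□)G′_□h_□λ| ≤ 1_{S′_□}(y)·B₀e^{δ₀ρ}(k_P + k_C)·e^{−δ₀d(y,y′)}|λ|`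
— n06-k's `h389_of_342` at the stacked letters (`D′ = stackDir ∇_{U,·}` with its entry from `DirSupSq37`, `P′_□ = costackDir P_{□,·}` with kernel `KP` by `KPd_sum`).
[cite: Balaban1985BackgroundPropagators, (3.89) p.409; Balaban1984PropagatorsII, (2.40)–(2.44) p.230] -/
theorem h389_dir [Fintype X] [Fintype Y] {ρ N N' Cℓ B₀ δ₀ : ℝ} {κ : Sizes} (hB₀ : 0 ≤ B₀) (hδ₀ : 0 ≤ δ₀)
    (hs : StaticOK 𝔬 ρ N N' Cℓ κ) (hl : Local342 𝔬 R H B₀ δ₀ U) (hT : DirSupSq37 𝔬 𝔡 R H U) (hi : Identities₂ 𝔬 𝔡 𝔩 R H U) :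
    ∀ i, HasMajorant (g := toB6 g R H) 𝔬.blk (KopDir 𝔬 𝔡 𝔩 U i * 𝔬.Gsq U i * mulOp (𝔬.h i))
      (fun (a b : g.Site) => if a ∈ 𝔬.S' i then B₀ * Real.exp (δ₀ * ρ) * (κ.kP + κ.kC) * Real.exp (-(δ₀ * g.dist a b)) else 0) := by
  have hlen : ∀ y : g.Site, 0 ≤ g.len y := fun y => (hs.lenpos y).le
  have htri : Triangle254 (toB6 g R H) := fun a b c => hs.tri a b c
  have h := h389_of_342 (R := R) (H := H) 𝔬.blk (fun p : X × Dir => 𝔬.blk p.1) δ₀ ρ B₀ κ.kP κ.kC 𝔬.S' 𝔬.h 𝔬.KP 𝔬.KC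
    hB₀ hδ₀ htri hlen hs.hh hs.KP_nonneg hs.KP_loc hs.KP_row hs.KC_nonneg hs.KC_loc hs.KC_row hl.e0
    (fun i => hT.hasMajorantHom_stackDd i _ (hl.e1 i)) hi.hasMajorantHom_costackP hi.hC
  intro i
  rw [KopDir_eq_stacked]
  exact h i

/-- ★ **(3.89) SUMMED: `R′ ≪ N′θ·e^{−δ₀d}`**, θ = B₀e^{δ₀ρ}(k_P + k_C). [cite: Balaban1985BackgroundPropagators, (3.89) p.409 («overlap finitely often»)] -/
theorem hR_dir [Fintype X] [Fintype Y] {ρ N N' Cℓ B₀ δ₀ : ℝ} {κ : Sizes} (hB₀ : 0 ≤ B₀) (hδ₀ : 0 ≤ δ₀) (hκ : κ.Nonneg)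
    (hs : StaticOK 𝔬 ρ N N' Cℓ κ) (hl : Local342 𝔬 R H B₀ δ₀ U) (hT : DirSupSq37 𝔬 𝔡 R H U) (hi : Identities₂ 𝔬 𝔡 𝔩 R H U) :
    HasMajorant (g := toB6 g R H) 𝔬.blk (RprimeDir 𝔬 𝔡 𝔩 U)
      (fun (a b : g.Site) => N' * (B₀ * Real.exp (δ₀ * ρ) * (κ.kP + κ.kC)) * Real.exp (-(δ₀ * g.dist a b))) := by
  have hk12 : 0 ≤ κ.kP + κ.kC := add_nonneg hκ.kP hκ.kC
  have h389 := h389_dir hB₀ hδ₀ hs hl hT hi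
  have hRa : ∀ i, HasMajorant (g := toB6 g R H) 𝔬.blk (KopDir 𝔬 𝔡 𝔩 U i * 𝔬.Gsq U i * mulOp (𝔬.h i))
      (fun (a b : g.Site) => (if a ∈ 𝔬.S' i then (1 : ℝ) else 0) *
        (B₀ * Real.exp (δ₀ * ρ) * (κ.kP + κ.kC) * Real.exp (-(δ₀ * g.dist a b)))) :=
    fun i => hasMajorant_mono (g := toB6 g R H) 𝔬.blk (h389 i) fun a b => le_of_eq (by split_ifs <;> simp)
  have hloc := hasMajorant_localSum (G := toB6 g R H) 𝔬.blk (fun i => KopDir 𝔬 𝔡 𝔩 U i * 𝔬.Gsq U i * mulOp (𝔬.h i))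
    (fun i (a : g.Site) => if a ∈ 𝔬.S' i then (1 : ℝ) else 0)
    (fun (a b : g.Site) => B₀ * Real.exp (δ₀ * ρ) * (κ.kP + κ.kC) * Real.exp (-(δ₀ * g.dist a b))) N'
    (fun a b => mul_nonneg (mul_nonneg (mul_nonneg hB₀ (Real.exp_nonneg _)) hk12) (Real.exp_nonneg _)) hRa hs.cnt'
  exact hasMajorant_mono (g := toB6 g R H) 𝔬.blk hloc fun a b => le_of_eq (by ring)

/-- ★ **THE TRANSPOSED CUBE MAJORANT OF `M_{h_□}G′_□K(h_□)ᵗ` OVER THE DIRECTION LETTERS** (`rightR_cube_majorant_dir` at the schema letters):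
`1_{S′_□}(y′)B₀e^{δ₀ρ}(k_{Pᵗ} + C_ℓk_{Cᵗ})·Lʲη(L^{j′}η)⁻¹·e^{−δ₀d(y,y′)}`. [cite: Balaban1985BackgroundPropagators, (3.88)–(3.89) p.409; Balaban1984PropagatorsII, (2.52)–(2.55) p.232] -/
theorem hV_cube_dir [Fintype X] [Fintype Y] {ρ N N' Cℓ B₀ δ₀ : ℝ} {κ : Sizes} (hB₀ : 0 ≤ B₀) (hδ₀ : 0 ≤ δ₀) (hCℓ : 0 ≤ Cℓ) (hκ : κ.Nonneg)
    (hs : StaticOK 𝔬 ρ N N' Cℓ κ) (hl : Local342 𝔬 R H B₀ δ₀ U) (hT : DirSupSq37 𝔬 𝔡 R H U) (hi : Identities₂ 𝔬 𝔡 𝔩 R H U) (i : ι) :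
    HasMajorant (g := toB6 g R H) 𝔬.blk (mulOp (𝔬.h i) * 𝔬.Gsq U i * KoptDir 𝔬 𝔡 𝔩 U i)
      (fun (a b : g.Site) => (if b ∈ 𝔬.S' i then (1 : ℝ) else 0) * (B₀ * Real.exp (δ₀ * ρ) * (κ.kPt + Cℓ * κ.kCt)) *
        (g.len a * (g.len b)⁻¹) * Real.exp (-(δ₀ * g.dist a b))) := by
  have htri : Triangle254 (toB6 g R H) := fun a b c => hs.tri a b c
  exact rightR_cube_majorant_dir (R := R) (H := H) 𝔬.blk δ₀ ρ B₀ κ.kPt κ.kCt Cℓ (𝔬.S i) (𝔬.S' i) (𝔬.h i) (𝔬.KPt i)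
    (𝔬.KCt i) (𝔩.KPtd i) hB₀ hδ₀ hκ.kPt hκ.kCt hCℓ htri hs.lenpos (hs.hh i) (hs.hS i) (hs.comp i) (hs.KPt_loc i)
    (hs.KPt_col i) (hi.KPtd_nonneg i) (hi.KPtd_sum i) (hs.KCt_nonneg i) (hs.KCt_loc i) (hs.KCt_col i) (hl.e0 i)
    (fun μ => hT.right i _ (hl.e2 i) μ) (hi.hPt i) (hi.hCt i)

/-- ★ **`V ≪ N′θᵗ·Lʲη(L^{j′}η)⁻¹e^{−δ₀d}`**, θᵗ = B₀e^{δ₀ρ}(k_{Pᵗ} + C_ℓk_{Cᵗ}) (summed with `N′` on the input side). [cite: Balaban1985BackgroundPropagators, (3.89) p.409] -/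
theorem hV_dir [Fintype X] [Fintype Y] {ρ N N' Cℓ B₀ δ₀ : ℝ} {κ : Sizes} (hB₀ : 0 ≤ B₀) (hδ₀ : 0 ≤ δ₀) (hCℓ : 0 ≤ Cℓ)
    (hκ : κ.Nonneg) (hs : StaticOK 𝔬 ρ N N' Cℓ κ) (hl : Local342 𝔬 R H B₀ δ₀ U) (hT : DirSupSq37 𝔬 𝔡 R H U)
    (hi : Identities₂ 𝔬 𝔡 𝔩 R H U) :
    HasMajorant (g := toB6 g R H) 𝔬.blk (VDir 𝔬 𝔡 𝔩 U)
      (fun (a b : g.Site) => N' * (B₀ * Real.exp (δ₀ * ρ) * (κ.kPt + Cℓ * κ.kCt)) * g.len a * (g.len b)⁻¹ *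
        Real.exp (-(δ₀ * g.dist a b))) := by
  have hlen0 : ∀ y : g.Site, 0 ≤ g.len y := fun y => (hs.lenpos y).le
  have hVi : ∀ i, HasMajorantHom (g := toB6 g R H) 𝔬.blk 𝔬.blk (mulOp (𝔬.h i) * 𝔬.Gsq U i * KoptDir 𝔬 𝔡 𝔩 U i)
      (fun (a b : g.Site) => (if b ∈ 𝔬.S' i then (1 : ℝ) else 0) * (B₀ * Real.exp (δ₀ * ρ) * (κ.kPt + Cℓ * κ.kCt)) *
        (g.len a * (g.len b)⁻¹) * Real.exp (-(δ₀ * g.dist a b))) := fun i =>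
    (hasMajorantHom_iff (g := toB6 g R H) 𝔬.blk _ _).mpr (hV_cube_dir hB₀ hδ₀ hCℓ hκ hs hl hT hi i)
  rw [VDir, ← hasMajorantHom_iff (g := toB6 g R H) 𝔬.blk]
  refine hasMajorantHom_mono (g := toB6 g R H) 𝔬.blk 𝔬.blk
    (hasMajorantHom_fintypeSum 𝔬.blk 𝔬.blk (fun i => mulOp (𝔬.h i) * 𝔬.Gsq U i * KoptDir 𝔬 𝔡 𝔩 U i) _ hVi) fun (a b : g.Site) => ?_
  have h3 : 0 ≤ B₀ * Real.exp (δ₀ * ρ) * (κ.kPt + Cℓ * κ.kCt) * (g.len a * (g.len b)⁻¹) * Real.exp (-(δ₀ * g.dist a b)) :=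
    mul_nonneg (mul_nonneg (mul_nonneg (mul_nonneg hB₀ (Real.exp_nonneg _)) (add_nonneg hκ.kPt (mul_nonneg hCℓ hκ.kCt)))
      (mul_nonneg (hlen0 a) (inv_nonneg.mpr (hlen0 b)))) (Real.exp_nonneg _)
  calc (∑ i, (if b ∈ 𝔬.S' i then (1 : ℝ) else 0) * (B₀ * Real.exp (δ₀ * ρ) * (κ.kPt + Cℓ * κ.kCt)) *
          (g.len a * (g.len b)⁻¹) * Real.exp (-(δ₀ * g.dist a b)))
      = (∑ i, if b ∈ 𝔬.S' i then (1 : ℝ) else 0) * (B₀ * Real.exp (δ₀ * ρ) * (κ.kPt + Cℓ * κ.kCt) *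
          (g.len a * (g.len b)⁻¹) * Real.exp (-(δ₀ * g.dist a b))) := by
        rw [Finset.sum_mul]
        exact Finset.sum_congr rfl fun i _ => by ring
    _ ≤ N' * (B₀ * Real.exp (δ₀ * ρ) * (κ.kPt + Cℓ * κ.kCt) * (g.len a * (g.len b)⁻¹) * Real.exp (-(δ₀ * g.dist a b))) :=
        mul_le_mul_of_nonneg_right (hs.cnt' b) h3
    _ = N' * (B₀ * Real.exp (δ₀ * ρ) * (κ.kPt + Cℓ * κ.kCt)) * g.len a * (g.len b)⁻¹ * Real.exp (-(δ₀ * g.dist a b)) := by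
        ring

/-! ## §4 The v1 hypothesis schemas that spell the K-letter, RE-TYPED at `KopDir` ∕ `KoptDir` (text otherwise verbatim) -/

section Schemas

variable {P PX PY : Type}

/-- **v2 of `B9RWSums343HolderGp.HolderV37`**: the terms `h_□G′_□K(h_□)ᵗ` of the transposed (3.88) read through the probes `Φ^X_β(U)`, with
`K(h_□)ᵗ = KoptDir` (direction letters).  POSITED; a HYPOTHESIS SCHEMA. [cite: Balaban1985BackgroundPropagators, (3.88)–(3.89) p.409 + (3.43) p.398 + (3.100) p.413; Balaban1984PropagatorsII, (2.40)–(2.44) p.230] -/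
structure HolderV37Dir (𝔬 : Ops g B X Y ι) (𝔡 : DirOps37 𝔬 Dir) (𝔩 : DirLetters37 𝔬 Dir) (𝔭 : HolderProbes g B X Y PX PY) (R : ℝ) (H : Prop)
    (BV : ℝ → ℝ) (δ₀ : ℝ) (U : B.Cfg) : Prop where
  probeV : ∀ β : ℝ, 0 ≤ β → β < 1 → ∀ i, HasMajorantHom (g := toB6 g R H) 𝔬.blk 𝔭.blkPX
    (𝔭.ΦX U β ∘ₗ (mulOp (𝔬.h i) * 𝔬.Gsq U i * KoptDir 𝔬 𝔡 𝔩 U i))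
    (fun (y y' : g.Site) => (if y' ∈ 𝔬.S' i then (1 : ℝ) else 0) * BV β *
      (g.len y ^ (1 - β) * (g.len y')⁻¹) * Real.exp (-(δ₀ * g.dist y y')))

/-- **v2 of `B9RWSums344InputGp.FactorsInput37`**: the terms `K(h_□)G′_□h_□∇\*_U` of `R′∇\*_U` read from `bH ε` into the sharp blocks, `K(h_□) = KopDir`.
POSITED; a HYPOTHESIS SCHEMA. [cite: Balaban1985BackgroundPropagators, (3.88)–(3.89) p.409 + (3.44) p.398; Balaban1984PropagatorsII, (2.40)–(2.44) p.230] -/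
structure FactorsInput37Dir [Fintype X] [Fintype Y] (𝔬 : Ops g B X Y ι) (𝔡 : DirOps37 𝔬 Dir) (𝔩 : DirLetters37 𝔬 Dir) (R : ℝ) (H : Prop)
    (bH : ℝ → BlockNorm (toB6 g R H) (Y → ℝ)) (θI : ℝ → ℝ) (δ₀ : ℝ) (U : B.Cfg) : Prop where
  facD : ∀ ε : ℝ, 0 < ε → ∀ i : ι, HasMaj (bH ε) (BlockNorm.ofBlocks (toB6 g R H) 𝔬.blk)
    ((KopDir 𝔬 𝔡 𝔩 U i * 𝔬.Gsq U i * mulOp (𝔬.h i)) ∘ₗ 𝔬.Dstar U)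
    (fun (y y' : g.Site) => (if y ∈ 𝔬.S' i then (1 : ℝ) else 0) * (θI ε * (g.len y)⁻¹ * Real.exp (-(δ₀ * g.dist y y'))))

/-- **v2 of `B9RWSums344InputPair.FactorsInputPair37`**: the terms `K(h_□)G′_□h_□∇\*_{U,μ}` of `R′∇\*_μ` from `bHX ε`, `K(h_□) = KopDir`.  POSITED; a HYPOTHESIS SCHEMA.
[cite: Balaban1985BackgroundPropagators, (3.88)–(3.89) p.409 + (3.44) p.398] -/
structure FactorsInputPair37Dir [Fintype X] (𝔬 : Ops g B X Y ι) (𝔡 : DirOps37 𝔬 Dir) (𝔩 : DirLetters37 𝔬 Dir) (R : ℝ) (H : Prop)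
    (bHX : ℝ → BlockNorm (toB6 g R H) (X → ℝ)) (θI : ℝ → ℝ) (δ₀ : ℝ) (U : B.Cfg) : Prop where
  facDs : ∀ ε : ℝ, 0 < ε → ∀ (i : ι) (μ : Dir), HasMaj (bHX ε) (BlockNorm.ofBlocks (toB6 g R H) 𝔬.blk)
    ((KopDir 𝔬 𝔡 𝔩 U i * 𝔬.Gsq U i * mulOp (𝔬.h i)) ∘ₗ 𝔡.Dsd U μ)
    (fun (y y' : g.Site) => (if y ∈ 𝔬.S' i then (1 : ℝ) else 0) * (θI ε * (g.len y)⁻¹ * Real.exp (-(δ₀ * g.dist y y'))))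

/-- **v2 of `B9RWSums346MixedPair.FactorsL2Mixed37`**: the terms `K(h_□)G′_□h_□∇\*_{U,μ}` in the block-L² norms, `K(h_□) = KopDir`.  POSITED; a HYPOTHESIS SCHEMA.
[cite: Balaban1985BackgroundPropagators, (3.88)–(3.89) p.409 + (3.46) p.398; Balaban1984PropagatorsII, (2.40)–(2.44) p.230] -/
structure FactorsL2Mixed37Dir [Fintype X] (𝔬 : Ops g B X Y ι) (𝔡 : DirOps37 𝔬 Dir) (𝔩 : DirLetters37 𝔬 Dir) (R : ℝ) (H : Prop) (θM δ₀ : ℝ)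
    (U : B.Cfg) : Prop where
  facDs : ∀ (i : ι) (μ : Dir), BlockBd (g := toB6 g R H) 𝔬.blk 𝔬.blk
    ((KopDir 𝔬 𝔡 𝔩 U i * 𝔬.Gsq U i * mulOp (𝔬.h i)) ∘ₗ 𝔡.Dsd U μ)
    (fun (y y' : g.Site) => (if y ∈ 𝔬.S' i then (1 : ℝ) else 0) * (θM * g.len y ^ (-1 : ℝ) * Real.exp (-(δ₀ * g.dist y y'))))

/-- **v2 of `B9RWSums346SecondDiffGp.FactorsL2Second37`**: the terms `K(h_□)G′_□h_□∇\*_ν∇\*_μ` in the block-L² norms, `K(h_□) = KopDir`.  POSITED; a HYPOTHESIS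
SCHEMA. [cite: Balaban1985BackgroundPropagators, (3.88)–(3.89) p.409 + (3.46) p.398; Balaban1984PropagatorsII, (2.40)–(2.44) p.230] -/
structure FactorsL2Second37Dir [Fintype X] (𝔬 : Ops g B X Y ι) (𝔡 : DirOps37 𝔬 Dir) (𝔩 : DirLetters37 𝔬 Dir) (R : ℝ) (H : Prop) (θ3 δ₀ : ℝ)
    (U : B.Cfg) : Prop where
  facDD : ∀ (i : ι) (ν μ : Dir), BlockBd (g := toB6 g R H) 𝔬.blk 𝔬.blk
    ((KopDir 𝔬 𝔡 𝔩 U i * 𝔬.Gsq U i * mulOp (𝔬.h i)) ∘ₗ (𝔡.Dsd U ν ∘ₗ 𝔡.Dsd U μ))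
    (fun (y y' : g.Site) => (if y ∈ 𝔬.S' i then (1 : ℝ) else 0) *
      (θ3 * g.len y ^ (-2 : ℝ) * Real.exp (-(δ₀ * g.dist y y'))))

/-- **v2 of `B9RWSums346TwoGp.FactorsL2_37`**: the terms `K(h_□)G′_□h_□∇\*_U` of `R′∇\*_U` in the L² block norms, `K(h_□) = KopDir` (the E-role `∇\*_U` stays
the slice letter `𝔬.Dstar`).  POSITED; a HYPOTHESIS SCHEMA. [cite: Balaban1985BackgroundPropagators, (3.88)–(3.89) p.409 + (3.46) p.398; Balaban1984PropagatorsII, (2.40)–(2.44) p.230] -/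
structure FactorsL2_37Dir [Fintype X] [Fintype Y] (𝔬 : Ops g B X Y ι) (𝔡 : DirOps37 𝔬 Dir) (𝔩 : DirLetters37 𝔬 Dir) (R : ℝ) (H : Prop) (θ2 δ₀ : ℝ)
    (U : B.Cfg) : Prop where
  facD : ∀ i : ι, BlockBd (g := toB6 g R H) 𝔬.blkY 𝔬.blk ((KopDir 𝔬 𝔡 𝔩 U i * 𝔬.Gsq U i * mulOp (𝔬.h i)) ∘ₗ 𝔬.Dstar U)
    (fun (y y' : g.Site) => (if y ∈ 𝔬.S' i then (1 : ℝ) else 0) * (θ2 * (g.len y)⁻¹ * Real.exp (-(δ₀ * g.dist y y'))))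

end Schemas

end

end Literature.MathematicalPhysics.QuantumFieldTheory.Balaban1983to89.B9Thm37KLetterDir
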